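import Mathlib
import HarnessLib
import Summits.AtomisticToContinuum.FouriersLaw.Theses.JunctionLocality
import Summits.AtomisticToContinuum.FouriersLaw.Theorems.JunctionLocalityConductanceLowerBoundFloorEquivalence

/-!
# Line `ForecastSensitivitySketch` — skeleton v3 (lead c3, 2026-08-17): the crux IS the transmission-gradient floor

Crux `JunctionLocality.ConductanceLowerBound` (item stmt-AtomisticToContinuum-11749; shared by routes JunctionLocality,
StaticAbelianSqueeze, ContactStieltjesMeasure, LogConcaveRigidity, ParityLiouvilleSeed): along unique weak steady-state families
of `pinnedChain ω₂ lam β γ` (all `> 0`), for every `T > 0` and response coefficients `D_N`: `∃ c > 0 ∃ N₁ ∀ N ≥ N₁, c ≤ D_N`.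

History of this skeleton: v1 = ideator-3 sketch; v2/v2.1 (lead 11749-0) registered four stubs — `stub_kuboLink` (F1),
`stub_rowSum` (F2), `stub_fisherSquare` (F3), `stub_transmissionGradientFloor` (the bet).  ALL THREE fixed-`N` stubs are now
LANDED (F1 p95958 `…StubKuboLink`, F2 p87148 `…StubRowSum`, F3 p89790 `…StubFisherSquare`), and lead 11749-1 landed the glue
`…FloorEquivalence` (p96126): `conductanceLowerBound_iff_floor : ConductanceLowerBound ↔ FLOOR`.  Hence v3 has exactly ONE
`sorry`, the floor, and the composition is the landed `conductanceLowerBound_of_floor`.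

## The one registered stub (the bet = the crux in equilibrium form)

* `stub_transmissionGradientFloor` — for all parameters `> 0`, `T > 0`: `∃ c > 0 ∃ L₁ ∀ L ≥ L₁ (L ≥ 2)`, every classical
  mean-zero `C² ∩ L²(μ_T)` solution `g` of `L_{T,T} g = −(p_0² − T)` on the `L`-chain (the LEFT forward field; it exists and is
  unique — `stub_plainForwardField`, `forwardField_unique`, landed) satisfies `c ≤ (L−1)·∫ (∂_{p_{L−1}} g)² dμ_T`.
  Readings (all exact, all landed or in crux NOTES): `D_L = (L−1)(2γ³/T)‖∂_{p_{L−1}}g‖²` (`response_eq_dirichlet`);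
  `(2γ³/T)‖∂_{p_{L−1}}g‖² = G_L = γ·(fraction of energy injected at site 0 that exits through the FAR bath)`;
  odd-field form `G_L = γ/2 − (2γ³/T)‖∂_{p_{L−1}} a‖²`, `a = (g − g∘R)/2 = ½(−L)⁻¹(k_0 − k_{L−1})` (from the landed
  conservation identity `γ(g + g∘R) = H − ⟨H⟩`), so the floor is an UPPER bound `‖∂_p a‖² ≤ T/(4γ²) − c'/(L−1)` on the
  contact Dirichlet energy of the antisymmetric (genuinely non-equilibrium) response field.
  Status: OPEN — it is the positivity half of Fourier's law for a deterministic anharmonic bulk; no `N`-uniform engine in print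
  (barrier `FixedLengthNoConductivityControl`; crux NOTES B1–B7; Disproof §6).

## Composition (sorry-free given the stub): `ConductanceLowerBound_of`.

## Certificate interface (lead c5, 2026-08-17; all LANDED `--supports`, namespace `…Cruxes.ConductanceLowerBound.ForecastSensitivity`)
The stub is also reachable through the kernel-checked INF-SIDE VARIATIONAL PRINCIPLE:
* `conductanceLowerBound_of_certificates` / `floor_of_certificates` (…Theorems/…CertificatePrinciple.lean, p156405): if for all
  parameters `> 0` there are `c > 0`, `L₁` such that every `L`-chain (`L ≥ L₁`) carries an ADMISSIBLE PAIR `(φ, χ)` — `φ, χ ∈ C²`,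
  contact gradients in `L²(μ_T)`, `χ ∈ L²(μ_T)`, `γ S_B φ + X_H χ = −(p_0² − T)` pointwise — of contact Dirichlet cost
  `Σ_{b∈{0,L−1}} (‖∂_{p_b}φ‖² + ‖∂_{p_b}χ‖²) ≤ T/γ² − c/(L−1)`, then the floor (constant `c/2`) and the crux hold
  (`certificate_principle`: `E_near(g) + E_far(g) ≤ cost(φ,χ)`, equality at `((g+g∘Θ)/2, (g−g∘Θ)/2)`; sum rule `E_near = T/γ² − 3E_far`).
* Exact constraints on admissible pairs: `certificate_pairing_hamiltonian` (p156210) `γ(⟨p_0,∂_{p_0}φ⟩ + ⟨p_{L−1},∂_{p_{L−1}}φ⟩) = T`;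
  `certificate_pairing_source` (p156213) `γT⟨p_0,∂_{p_0}φ⟩ − ⟨χ, p_0∂_{q_0}H⟩ = T²`; `certificate_pairing_field` (p156109).
* TWO-ENDS OBSTRUCTION (…CertificateObstruction.lean, p156453): `∂_{p_{L−1}}φ ≡ 0` or `χ` reversal-even ⟹ `‖∂_{p_0}φ‖² ≥ T/γ²`
  (no gain over the trivial pair `((p_0²−T)/(2γ), 0)`); every pair has `‖∂_{p_0}φ‖² + ‖∂_{p_{L−1}}φ‖² ≥ T/(2γ²)` (ceiling `G_L ≤ γ/2`).
  So a floor certificate is a cross-chain object: `φ` loads the far bath, `χ` is reversal-odd and correlated with `−p_0∂_{q_0}H`.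
-/

noncomputable section

open MeasureTheory Filter Topology
open scoped ContDiff
open Literature.MathematicalPhysics.KineticTheory.HeatConduction
open Summit.AtomisticToContinuum.FouriersLaw.Theorems.SuperadditiveResistance.DeviceLiouville (kin)

namespace Summit.AtomisticToContinuum.FouriersLaw.Cruxes.ConductanceLowerBound.ForecastSensitivity

/-! ## §1 The registered stub -/

/-- **THE BET — TRANSMISSION-GRADIENT FLOOR (`N`-uniform, XL; held by the lead; EQUIVALENT to the crux by the landed
`conductanceLowerBound_iff_floor`).**  For all parameters `> 0` and `T > 0` there are `c > 0` and `L₁` such that for every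
`L ≥ L₁` (and `L ≥ 2`) every classical mean-zero `C² ∩ L²(μ_T)` left forward field `g` of the `L`-chain satisfies
`c ≤ (L−1) · ‖∂_{p_{L−1}} g‖²_{L²(μ_T)}`. -/
theorem stub_transmissionGradientFloor :
    ∀ (ω₂ lam β γ T : ℝ), 0 < ω₂ → 0 < lam → 0 < β → 0 < γ → 0 < T →
      ∃ c : ℝ, 0 < c ∧ ∃ L₁ : ℕ, ∀ (L : ℕ) (hL : 2 ≤ L), L₁ ≤ L → ∀ g : PhaseSpace L → ℝ, ContDiff ℝ 2 g →
        MemLp g 2 ((pinnedChain ω₂ lam β γ).gibbsMeasure L T) →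
        ∫ x, g x ∂((pinnedChain ω₂ lam β γ).gibbsMeasure L T) = 0 →
        (∀ x, (pinnedChain ω₂ lam β γ).generator L T T g x = -(kin L 0 x - T)) →
        c ≤ ((L : ℝ) - 1) *
          ∫ x, (partialP (⟨L - 1, by omega⟩ : Fin L) g x) ^ 2 ∂((pinnedChain ω₂ lam β γ).gibbsMeasure L T) := by
  sorry

/-! ## §2 The composition (sorry-free given the stub) -/

/-- **COMPOSITION (the stub proves the crux BY NAME)** — the landed glue `conductanceLowerBound_of_floor` (Kubo link ∘ row sum ∘
far-contact Fisher square ∘ existence of the forward field) applied to the floor. -/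
theorem ConductanceLowerBound_of :
    Summit.AtomisticToContinuum.FouriersLaw.Theses.JunctionLocality.ConductanceLowerBound :=
  conductanceLowerBound_of_floor stub_transmissionGradientFloor

end Summit.AtomisticToContinuum.FouriersLaw.Cruxes.ConductanceLowerBound.ForecastSensitivity

end
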